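import Mathlib
import HarnessLib
import HarnessLib.Audit
import Summits.AtomisticToContinuum.Statement

/-!
Route: KineticWindows

CLOSED (retired) 2026-08-15T13:43:41Z by operator:999:1257524 — reason: not-a-thesis: assembly does not conclude the sub-problem Statement — note: D-0027 §2.1 audit (human 2026-08-15: routes that do not decide the summit are removed): the assembly concludes `Literature.MathematicalPhysics.KineticTheory.HydrodynamicLimit`, not the sub-problem statement; a NEW conforming route may be opened from the same idea (generated `closes : … → _root_.Hydr. The file is kept as the record of this route; refuted decls are indexed as negative knowledge (`ledger negatives`).

# Route KineticWindows — Two clocks — finite kinetic-window large deviations from local Gibbs data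
as the one-block input of Yau's entropy Gronwall

It suffices to show X_KW := (A) WINDOW LD ∧ (B) TAILS, where (A) = finite-KINETIC-WINDOW LARGE
DEVIATIONS FROM LOCAL GIBBS DATA:
for every continuous local-equilibrium profile (a, u₀, θ₀), every small reduced density σ, and every
FAST microscopic current
functional — kinetic part: a one-body F(x,v) of at most quadratic growth, orthogonal under the local
Maxwellian at each x to the collision
invariants 1, v, |v|² (crux KineticWindowLD, typed); collisional part: the contact momentum/energy
transfer minus its affine L²(local
Gibbs) projection onto the conserved fluctuation fields (crux CollisionalWindowLD, informal until
`collisionSum` is defined) — the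
exponential moment at scale N+1 of β(N+1)·(time average over a window of τ(N+1)^{-1/3}, i.e.
finitely many mean free times, of the
empirical functional along the DETERMINISTIC hard-sphere flow started from the local Gibbs law) is
exp(o(N)) for |β| ≤ β₀, for SOME
window τ = τ(ε) per tolerance ε (τ fixed as N → ∞: Lanford's regime in time, large-deviation in
strength, local Gibbs in data, fixed σ³
in density); and (B) = uniform integrability, before the first shock, of the cubic velocity moments
under the evolved law (crux
EnergyCurrentTails, typed; the corrected form of RelEntropyErgodic's LargeVelocityControl). X_KW ⟹
RelEntropyVanishing
(stmt-AtomisticToContinuum-0766, this route's typed target, shared with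
RelEntropyErgodic/ChaoticMixing/VanishingNoise) by the support item
EntropyClockReduction (Donsker–Varadhan entropy inequality for the window-averaged fast residual +
Liouville invariance of relative
entropy ⇒ dh/ds ≤ (h + Λ_τ(β) + o(1))/β, Gronwall at FIXED β, then τ → ∞), and RelEntropyVanishing ⟹
the conjunct (assembly 0769).
Realises idea card kinetic-windows-inside-yau ("two clocks": kinetic theory answers only over
finitely many collision times; Yau's
entropy carries macroscopic time).
Lean: `∀ (a θ₀ : Literature.MathematicalPhysics.KineticTheory.T3 → ℝ) (u₀ :
Literature.MathematicalPhysics.KineticTheory.T3 → Literature.MathematicalPhysics.KineticTheory.V3),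
Continuous a → Continuous θ₀ → Continuous u₀ → (∀ x, 0 < a x) → (∀ x, 0 < θ₀ x) → ∃ σ₀ : ℝ, 0 < σ₀ ∧
∀ σ : ℝ, 0 < σ → σ < σ₀ → ∀ Φ : (N : ℕ) → Literature.Analysis.FluidPDE.HardSphereFlow
(Literature.Analysis.FluidPDE.Torus.geometry (Fin 3))
(Literature.MathematicalPhysics.KineticTheory.hsDiameter σ N) (N + 1), ∀ F :
Literature.MathematicalPhysics.KineticTheory.T3 × Literature.MathematicalPhysics.KineticTheory.V3 →
ℝ, Continuous F → (∃ C : ℝ, ∀ y, |F y| ≤ C * (1 + ‖y.2‖ ^ 2)) → (∀ x, ∫ v, F (x, v) *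
Literature.Analysis.FluidPDE.localMaxwellian 1 (θ₀ x) (u₀ x) v = 0) → (∀ x (j : Fin 3), ∫ v, F (x,
v) * v j * Literature.Analysis.FluidPDE.localMaxwellian 1 (θ₀ x) (u₀ x) v = 0) → (∀ x, ∫ v, F (x, v)
* ‖v‖ ^ 2 * Literature.Analysis.FluidPDE.localMaxwellian 1 (θ₀ x) (u₀ x) v = 0) → ∃ β₀ : ℝ, 0 < β₀ ∧
∀ β : ℝ, |β| ≤ β₀ → ∀ ε : ℝ, 0 < ε → ∃ τ : ℝ, 0 < τ ∧ ∃ N₀ : ℕ, ∀ N : ℕ, N₀ ≤ N → ∫⁻ z,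
ENNReal.ofReal (Real.exp (β * ∑ i : Fin (N + 1), (τ * ((N : ℝ) + 1) ^ (-(1 / 3 : ℝ)))⁻¹ * ∫ r in (0
: ℝ)..(τ * ((N : ℝ) + 1) ^ (-(1 / 3 : ℝ))), F (((Φ N).flow r z) i)))
∂(Literature.MathematicalPhysics.KineticTheory.localGibbsLaw σ a u₀ θ₀ N (Φ N)) ≤ ENNReal.ofReal
(Real.exp (ε * ((N : ℝ) + 1)))`

## Assembly
KineticWindowLD (kinetic fast residual) ∧ CollisionalWindowLD (collisional fast residual; informal
item filed after open) ∧
EnergyCurrentTails ∧ the static inputs already on the ledger (LocalGibbsConcentration 0767,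
VirialEosIdentification 0782 in its
linear-response form, HsEosLowDensity 0768) ⟹ RelEntropyVanishing (0766) by the support item
EntropyClockReduction (filed after open,
informal): (i) exact entropy-production identity for hard-sphere flows relative to the
time-dependent local Gibbs law — H(f_t|ψ_t) =
H(f_0|ψ_t∘Φ_t) by Liouville invariance; along a trajectory log ψ_t changes by kinetic terms between
collisions and by
[λ(x_i)−λ(x_j)]·Δη_i at collisions (= collisional transfer, error O(N^{2/3})); (ii) the Euler
equations in entropy variables plus the
fluctuation–response form of 0782 cancel the affine (slow) part of the current fields, density
fluctuations included, leaving the FAST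
residual (kinetic: current minus its L²(M_{u,θ}) projection onto span{1,v,|v|²} — exact because
ideal-gas fluxes are degree-1
homogeneous; collisional: minus its L²(ψ) projection) plus a cubic tail; (iii) window averaging s ↦
[s, s + τ(N+1)^{-1/3}]
(error O(w‖λ‖_{C²})); (iv) Donsker–Varadhan for the window functional — a function of the time-s
configuration because the dynamics is
deterministic — under f_s versus ψ_s: E_{f_s}[Ȳ] ≤ (h(s) + Λ_{N,τ,s}(β) + o(1))/β; uniformity in s ∈
[0,t] from the pointwise cruxes
on a β-disc by the Hölder/relative-entropy perturbation bound between nearby local Gibbs laws (ε-net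
in s); (v) tail ≤ C·sup_s
E_{f_s}[(N+1)⁻¹Σ|v_i|³1{|v_i|>M}] (EnergyCurrentTails); (vi) Gronwall at FIXED β: limsup_N h_N(t) ≤
e^{t/β} t sup_s Λ_{τ,s}(β)/β,
then τ → ∞ along τ(ε); (vii) h_N(0) → 0 and the reference concentration from 0767 and the LLN
hypothesis. Then 0769:
RelEntropyVanishing → HydrodynamicLimit (entropy inequality against exponentially concentrating
references; shared, typed).

Rationale: WHY THIS LINE. The only positive-density Euler derivation (OllaVaradhanYau1993, Thm 2.1 with weak
noise; Yau1991; KipnisLandim1999 Ch. 6; Varadhan1993EntropyMethods §5)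
uses noise at exactly one place: the local ergodic theorem (OVY Thm 3.10, §4 steps (A)–(E), noise in
step (B)), i.e. the one-block
input, which for deterministic spheres is the BoltzmannHypothesis/MacroErgodicity wall (routes
RelEntropyErgodic 0779, ChaoticMixing
0830). This line keeps the entropy clock and changes the currency of the one-block input: because
relative entropy is Liouville-invariant,
the entropy inequality transfers typicality of the dynamics RESTARTED from the explicit local Gibbs
law ψ_s to the true law at cost
h(s)N, so the whole dynamical content becomes a large-deviation estimate over a macroscopically
infinitesimal window — finitely many mean
free times from (almost-)invariant Gibbs-type data, the time regime where deterministic hard-sphere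
technology is strongest
(Lanford1975; BodineauGallagherSaintRaymondInvent2016; BGSSAnnals2023 = arXiv:2008.10403;
BGSSCPAM2023 = arXiv:2012.03813;
BodineauEtAl2024; LeBihan2022 = arXiv:2212.04392), now to be run at FIXED small σ³ instead of
Boltzmann–Grad. Imported area:
kinetic theory / dynamical cluster and cumulant expansions of hard-sphere dynamics (probability),
nested inside the relative entropy
method; nothing is asked of kinetic theory beyond finite windows (no kinetic equation, no
τ-uniformity in N, no rate). Versus prior
routes: no invariant-measure classification (0779), no n-uniform mixing rate (0830), no
macroscopic-time cumulant expansion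
(DenseKineticExpansion 0804); versus the negatives on file (cards higher-drude-weights-subcoherence,
collisionless-corners-log-price):
KW is filed at FIXED β on a disc with one window per tolerance — the form those computations leave
standing.

RANKED CRUXES. #0 RelEntropyVanishing (target) — Yau's entropy form of the limit (shared typed
target stmt-AtomisticToContinuum-0766): for all continuous profiles ∃ σ₀ ∀ σ<σ₀ ∀ classical hs-Euler
solutions on [0,T) ∀ flow families, the initial local Gibbs laws are probability measures and, if
their fields converge at t = 0, then ∀ t < T there is an activity profile a_t whose local Gibbs law
(a_t, u_t, θ_t) concentrates its three empirical fields exponentially around (ρ, ρu, E)(t) and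
klDiv(lawAt Φ_N (localGibbs a₀ u₀ θ₀) t ‖ localGibbs a_t u_t θ_t)/(N+1) → 0. (why it might fail:
entropy production ≥ cN before the first shock for some smooth data (would close every entropy
route, not only this one); OVY prove it only with noise and bounded-gradient kinetic energy.)
[Yau1991, OllaVaradhanYau1993, Varadhan1993EntropyMethods]
#2 KineticWindowLD (crux) — FINITE-KINETIC-WINDOW LARGE DEVIATIONS OF FAST ONE-BODY FUNCTIONALS FROM
LOCAL GIBBS DATA (card crux 1, kinetic part). For continuous profiles a, θ₀ > 0, u₀ there is σ₀ > 0
such that for 0 < σ < σ₀, every family of hard-sphere flows Φ_N (N+1 spheres of diameter hsDiameter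
σ N on 𝕋³) and every continuous F : 𝕋³ × ℝ³ → ℝ with |F(x,v)| ≤ C(1+|v|²) that is orthogonal, under
the local Maxwellian M_{1,u₀(x),θ₀(x)} at every x, to 1, v_j (j = 1,2,3) and |v|²: ∃ β₀ > 0 ∀ |β| ≤
β₀ ∀ ε > 0 ∃ τ > 0 ∃ N₀ ∀ N ≥ N₀: ∫ exp(β Σ_i w_N⁻¹ ∫₀^{w_N} F(x_i(r), v_i(r)) dr) dλ^N ≤
exp(ε(N+1)), where w_N = τ(N+1)^{-1/3} (finitely many mean free times), (x_i(r), v_i(r)) = (Φ_N.flow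
r z)_i and λ^N = localGibbsLaw σ a u₀ θ₀ N Φ_N. I.e. Λ_τ(β) := limsup_N (N+1)⁻¹ log E exp(β(N+1)Ȳ_τ)
can be made ≤ ε by ONE suitable window, at FIXED small β — exactly what the entropy Gronwall
consumes; no rate, no monotonicity in τ, no uniformity of mixing in N. Finite at each N for |β| ≤ β₀
(quadratic growth + conservation of Σ|v_i|² + Gaussian data). Fails, correctly, for slow F
(conserved densities: Λ_τ ≡ static value) and for the ideal gas (free flight: Λ_τ ≡ Λ at τ → 0⁺).
[difficulty: open-problem] (why it might fail: a hidden slow one-body mode at fixed σ³ (none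
expected in the d=3 gas phase: kernel of the linearised hard-sphere operator = collision
invariants), or ring/recollision correlations keeping scale-N exponential moments of window averages
≥ cβ² beyond Lanford's time — open even for global Gibbs data.) [OllaVaradhanYau1993,
KipnisLandim1999, BGSSAnnals2023, BGSSCPAM2023, BodineauEtAl2024, LeBihan2022, Spohn1991]
#3 CollisionalWindowLD (crux, informal item stmt-AtomisticToContinuum-3678, typable after
defn-collisionSum) — the same finite-kinetic-window exponential-moment estimate for the FAST PART OF
THE COLLISIONAL MOMENTUM/ENERGY TRANSFER over the window (contact transfer summed over the
collisions of the trajectory, minus its affine L²(local Gibbs) projection onto the conserved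
fluctuation fields — the slow part whose coefficients are the collisional parts of the hs-Euler flux
Jacobian, ρθ(Z(ρσ³)−1)-terms, by fluctuation–response = 0782 in linear-response form). (why it might
fail: as #2, plus scale-N exponential moments of the collision COUNT in a window under Gibbs data
must be e^{O(N)} uniformly in N — expected, unproved at fixed σ³; an error in the static slow
projection shows up as a spurious non-decaying mean.) [Spohn1991, VanbeijerenErnst1973,
Resibois1978, BGSSAnnals2023, OllaVaradhanYau1993]
#4 EnergyCurrentTails (crux) — UNIFORM INTEGRABILITY OF THE ENERGY-CURRENT TAILS BEFORE THE FIRST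
SHOCK (card crux 3's irreducible tail input; the consumable, corrected form of RelEntropyErgodic's
LargeVelocityControl 0781, whose exponential-cubic-moment wording is false already at t = 0). For
continuous profiles ∃ σ₀ ∀ σ ∈ (0,σ₀) ∀ classical hs-Euler solutions (ρ,u,θ) on [0,T) ∀ flow
families Φ_N: if the local Gibbs fields converge at t = 0 to (ρ,ρu,E)(0), then ∀ t < T ∀ ε > 0 ∃ M ∃
N₀ ∀ N ≥ N₀ ∀ s ∈ [0,t]: E_{λ^N}[(N+1)⁻¹ Σ_i |v_i(s)|³ 1{|v_i(s)| > M}] ≤ ε, v_i(s) the velocities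
of (Φ_N.flow s z). On pre-shock horizons it follows from the catalogued open hypothesis
Literature.Barriers.AtomisticToContinuum.HighMomentumCutoff σ (Nachtergaele–Yau II.1 transcribed),
which is NOT assumed here (the item is weaker: cubic uniform integrability in mean, pre-shock only,
σ₀ profile-dependent). [difficulty: open-problem] (why it might fail: the deterministic dynamics
could focus energy ~N^{2/3} on O(1) particles with non-vanishing probability (f_s ≤ e^{κN}·Gibbs
only excludes events of Gibbs-cost e^{-κ'N}, and cubic tails have sub-exponential LD cost); no
maximum principle for hard-sphere energy cascades is known.) [NachtergaeleYau2003,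
OllaVaradhanYau1993, Spohn1991]
#9 EquilibriumShearWindowLD (support) — THE CHEAPEST TYPED SPECIAL CASE (card: "stake out first"):
KineticWindowLD for GLOBAL Gibbs data (constant activity a₀ > 0, u₀ = 0, constant temperature θ₀ >
0) and the kinetic SHEAR stress F(x,v) = φ(x)·v¹v² (continuous φ; automatically orthogonal to 1, v,
|v|² under the centred Maxwellian). Here the reference law is flow-INVARIANT (canonical Gibbs), so
Λ_{2τ} ≤ Λ_τ by Hölder, the long-finite-time equilibrium technology (BGSSCPAM2023, BodineauEtAl2024,
LeBihan2022) applies verbatim in time, and only the passage Boltzmann–Grad → fixed small σ³ over a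
FINITE window is new. First theorem to aim at; its negation kills the whole line. [difficulty:
open-problem] [BGSSCPAM2023, BodineauEtAl2024, LeBihan2022, BodineauGallagherSaintRaymondInvent2016]

#9 EntropyClockReduction (support, informal item stmt-AtomisticToContinuum-3681) — the glue: #2 ∧ #3
∧ #4 ∧ 0767 ∧ 0782 (linear-response form) ∧ 0768 ⟹ RelEntropyVanishing 0766 by the exact
entropy-production identity for hard-sphere flows (Liouville invariance; kinetic terms between
collisions, jumps [λ(x_i)−λ(x_j)]·Δη_i at collisions), cancellation of the affine slow part by the
Euler equations in entropy variables, window averaging, Donsker–Varadhan for the window functional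
under f_s vs ψ_s, ε-net uniformity in s from the β-disc, tail via #4, Gronwall at fixed β, τ → ∞.
[Yau1991, OllaVaradhanYau1993, KipnisLandim1999, Varadhan1993EntropyMethods]

TWO-LAYER PLAN. Foreseen glued split of KineticWindowLD once EquilibriumShearWindowLD closes (k =
2): KineticWindowLD ⇐ EquilibriumFastWindowLD
(all fast F, global Gibbs, any (u,θ) constants by Galilean/scaling covariance) → LocalGibbsTransfer
(almost-invariance of local Gibbs
laws over kinetic windows: relative entropy drift O(τ·Kn·N) = o(N), free in LD currency) →
KineticWindowLD. Foreseen split of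
EquilibriumFastWindowLD by ENGINE (one child, not three rival families): fixed-σ³ finite-window
dynamical cluster/cumulant expansion
with recollision classes resummed per mean free time (BGSSAnnals2023 §§2–4 pruning, LeBihan2022
conditioning) + decay from the
linearised hard-sphere collision gap. Nothing here is filed now.

KILL CRITERIA. ¬EquilibriumShearWindowLD (a fast kinetic functional whose window pressure Λ_τ(β)
stays ≥ c > 0 for all windows at some fixed small
β under GLOBAL Gibbs data at arbitrarily small σ — a hidden slow stress mode of the deterministic
gas) closes the route outright
(close --reason refuted:EquilibriumShearWindowLD or :KineticWindowLD). ¬EnergyCurrentTails (energy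
focusing before the first shock)
closes this AND every relative-entropy route with true kinetic energy (report to the
RelEntropyErgodic/VanishingNoise tenure planners).
¬RelEntropyVanishing closes all entropy routes. A theorem that scale-N exponential moments of
window-averaged BOUNDED fast functionals
cannot be o(N) beyond Lanford's time even at equilibrium would force a pivot to polynomial-moment
(Chebyshev) currency = card
iterated-limit-euler-finite-windows' √-Gronwall (then this route is superseded by that card's route,
if opened). GibbsErgodicity (0779)
or UniformLocalMixing+MixingToBlockEstimates (0830/0831) proved elsewhere would moot
KineticWindowLD/CollisionalWindowLD but not
EnergyCurrentTails.

NOT DECOMPOSED YET. Deliberately NOT items at open: the engine for KineticWindowLD (E1 L²/LD duality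
+ time-reversal pruning at fixed σ³, E2 empirical
Stosszahlansatz over the window, E3 information dilution along collision trees — card §Mechanism 6)
— they are proof strategies, split
children later; the uniform-in-s version of the window LD (ε-net + Hölder perturbation: glue inside
EntropyClockReduction); the
truncation/re-projection of the cubic heat flux (bounded fast part to KineticWindowLD, tail to
EnergyCurrentTails: glue); the
linear-response (second-derivative) extension of VirialEosIdentification 0782 and equivalence of
ensembles (static, cluster expansion:
attach to 0782/0768 when a grounder asks); the identification a_t = a(ρ_t, σ) (lives in 0766's ∃ a).
CollisionalWindowLD and
EntropyClockReduction are filed informally right after open (they need the definition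
`collisionSum`).

CHEAPEST FALSIFIER. (i) Analytic, free: compute Λ_τ(β) for the IDEAL GAS (must be τ-independent — it
is: free flight, Campbell; consistent, KW is not claimed
at σ = 0) and for the linear-Boltzmann/Ornstein–Uhlenbeck caricature of a tagged velocity (must
decay like β²/(ν₀τ)); (ii) the
collisionless-corner lower bound Λ_τ(β) ≥ βD − C log τ − C′(σ) (card
collisionless-corners-log-price) must stay compatible with the
filed form — it is (fixed β, τ → ∞); a version of that computation producing a τ-INDEPENDENT
positive lower bound at fixed small β
would kill KineticWindowLD instantly; (iii) event-driven MD at packing 0.05–0.2, N = 10³–10⁵,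
equilibrium start: the first four
cumulants of the window-averaged weighted shear stress must give (N+1)⁻¹ log E exp(β(N+1)Ȳ_τ)
decreasing in τ WITHOUT an N-growing
plateau (kit job for a refuter; not run here — hub is compute-free and the card is one-shot).

NUMBERS. Window w_N = τ(N+1)^{-1/3} macroscopic units = τ·πσ²√θ mean free times up to O(1);
Lanford/BGSS short-time validity ≈ 0.2 mean free
times (BGSSAnnals2023); Gaussian level of the window pressure Λ_τ(β) ≈ cβ²/(ν₀τ) with ν₀ the
linearised hard-sphere Boltzmann gap
(BarangerMouhot2005 explicit); exponential moment of the shear functional finite iff |β|·sup|φ| <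
1/θ_max (so β₀ depends on F, θ);
corner cost N(c₁ + 3 log τ) (card collisionless-corners-log-price) ⇒ no 1/τ rate uniform in β.

DEFINITION REQUESTS. `collisionSum` (topic Literature/Analysis/FluidPDE): for a hard-sphere
trajectory γ (IsHardSphereTrajectory G ε N γ), an interval
[a,b] and a pair functional g (indices i<j, pre- and post-collisional configuration), the sum of g
over the collision times in
collisionTimes G ε γ ∩ (a,b] and the colliding pairs (locally finite; binary by
IsHardSphereTrajectory.binary); numCollisions =
collisionSum of 1. Needed to type CollisionalWindowLD (collisional momentum/energy transfer over a
window) and the entropy-production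
identity in EntropyClockReduction; shared need with cards transient-covariance-identity /
contact-traces-are-bulk.

Novelty: Searches (2026-08-15): card + triage searches inherited (OVY doi:10.1007/bf02096727 pp. 3, 15–18
read; LeBihan2022 intro; KipnisLandim1999
Ch. 6 pp. 126–134; Spohn1991 Ch. 3 notes; lit hybrid/vsearch "local equilibrium Lanford restart",
"one block estimate kinetic time hard
spheres"); this session: `lit frontier AtomisticToContinuum --since 2020` (30 rows: all hard-sphere
fluctuation/LD papers Boltzmann–Grad —
arXiv:2602.04407, doi:10.1007/s10955-026-03570-w, arXiv:2605.19696; new engine-level neighbour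
doi:10.1002/cpa.70035, long-time
linearised Boltzmann at equilibrium), `lit bridges AtomisticToContinuum --cross any` (30 rows,
nothing on finite-window LD inside an
entropy method), `lit search --hybrid "hydrodynamic limit stochastic particle system with velocities
relative entropy local Maxwellian
one block estimate"` (10 held books: KipnisLandim1999, CIP1994, SaintRaymond2009, DemasiPresutti1991
…; DemasiPresutti1991 pp. 74,
126–128 READ: Carleman/Broadwell/HPP Euler regimes go THROUGH the kinetic equation up to times a|ln
ε| — kinetic-equation-first, the
opposite nesting), `lit vsearch "large deviations for the hard sphere gas at equilibrium over long
kinetic times beyond Lanford's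
time"` (8 textbook hits, none relevant), OVY PDF pp. 15, 17–18 re-read (Thm 3.10; §4 (A)–(E), noise
enters at (B)); `lit galaxy search
… --star all` saturated (queued > 90 s) twice — recorded, not claimed. Nearest prior art found:
OllaVaradhanYau1993 Thm 3.10/§4 and
KipnisLandim1999 Ch. 6 §1 (on  [refs: 10.1007/bf02096727, 10.1007/s10955-026-03570-w, 10.1002/cpa.70035, 2602.04407, 2605.19696, doi:10.1007/bf02096727, doi:10.1007/s10955-026-03570-w, doi:10.1002/cpa.70035, LeBihan2022, KipnisLandim1999, Spohn1991, CIP1994, SaintRaymond2009, DemasiPresutti1991, OllaVaradhanYau1993, BGSSAnnals2023, BGSSCPAM2023, BodineauEtAl2024]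

Barriers (technique_class: relative-entropy large-deviations kinetic-windows): - technique_class: relative-entropy large-deviations kinetic-windows
- Literature.Barriers.AtomisticToContinuum.BoltzmannHypothesisBarrier: evaded in form — no
stationary state of the infinite dynamics is classified and no local ergodic theorem is invoked; the
one-block input is KineticWindowLD, a finite-N, finite-window LD estimate from explicit local Gibbs
data (the barrier's own scope caveat: a finite-volume, N-uniform substitute evades it); its
ideal-gas kernel is respected (KW is false for free flight and is claimed only for 0 < σ < σ₀).
Residue: KW is a genuine open dynamical statement — the bet is that finitely many mean free times
near an almost-invariant Gibbs reference is the easiest question one can ask of deterministic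
spheres.
- Literature.Barriers.AtomisticToContinuum.MacroErgodicityBarrier: same class token, not met in
substance — no sector condition, no generator inversion, no fluctuation–dissipation decomposition
over macroscopic times; macro-ergodicity is replaced by a finite-window LD input (the barrier file
itself records that macro-ergodicity is sufficient, not necessary).
- Literature.Barriers.AtomisticToContinuum.HighMomentumCutoffBarrier: APPLIES and is NOT evaded — it
is isolated as the typed crux EnergyCurrentTails (cubic uniform integrability in f_s-mean,
pre-shock), the exact quantity the entropy-production identity consumes once the heat flux is
truncated and re-projected; inside the LD functional only quadratic-growth observables under
Gaussian d

History (route lifecycle, newest last):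
- 2026-08-15T13:43:41Z · CLOSED retired — not-a-thesis: assembly does not conclude the sub-problem Statement (operator:999:1257524)

sub-problem: HydrodynamicLimit · status: closed(retired) · opened planner-plancard-AtomisticToContinuum-Hydrody-53d9f76d-0 2026-08-15T11:21:39Z · rev 2 · ledger route-AtomisticToContinuum-KineticWindows
GENERATED by the gate from the ledger (D-0016/17). Provers cite these decls: `theorem foo : Summit.AtomisticToContinuum.HydrodynamicLimit.Theses.KineticWindows.<Decl> := …` in Summits/AtomisticToContinuum/HydrodynamicLimit/Theorems/<Name>.lean.
-/

namespace Summit.AtomisticToContinuum.HydrodynamicLimit.Theses.KineticWindows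

open scoped BigOperators Topology Manifold Classical MeasureTheory ProbabilityTheory Matrix InnerProductSpace ComplexConjugate ContinuousMap
open Filter Set Function TopologicalSpace MeasureTheory

attribute [summit_statement] _root_.HydrodynamicLimit

/-- item stmt-AtomisticToContinuum-0766 · target · rank 0 · open · by planner
why it might fail: entropy production ≥ cN before the first shock for some smooth data (would close every entropy route, not only this one); OVY prove it only with noise and bounded-gradient kinetic energy.
sources: Yau1991, OllaVaradhanYau1993, Varadhan1993EntropyMethods
[target] X_RE: for all continuous profiles ∃ σ₀ ∀ σ<σ₀ ∀ classical hs-Euler solutions on [0,T) ∀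
flows: the initial local Gibbs laws are probability measures and, if their fields converge at t=0,
then ∀ t<T ∃ activity profile a_t such that the reference local Gibbs law (a_t, u_t, θ_t) is a
probability measure whose empirical density/momentum/energy fields concentrate exponentially (≤ C
e^{-(N+1)/C}) around (ρ,ρu,E)(t), and klDiv(lawAt Φ_N (localGibbs a₀u₀θ₀) t ‖ localGibbs a_t u_t
θ_t)/(N+1) → 0. Yau1991; OllaVaradhanYau1993 Thm 1.1 (with noise). -/
@[route_item "route-AtomisticToContinuum-KineticWindows"]
def RelEntropyVanishing : Prop :=
  ∀ (a₀ θ₀ : Literature.MathematicalPhysics.KineticTheory.T3 → ℝ) (u₀ : Literature.MathematicalPhysics.KineticTheory.T3 → Literature.MathematicalPhysics.KineticTheory.V3), Continuous a₀ → Continuous θ₀ → Continuous u₀ → (∀ x, 0 < a₀ x) → (∀ x, 0 < θ₀ x) → ∃ σ₀ : ℝ, 0 < σ₀ ∧ ∀ σ : ℝ, 0 < σ → σ < σ₀ → ∀ (T : ℝ) (ρ θ : ℝ → Literature.MathematicalPhysics.KineticTheory.T3 → ℝ) (u : ℝ → Literature.MathematicalPhysics.KineticTheory.T3 → Literature.MathematicalPhysics.KineticTheory.V3),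 Literature.MathematicalPhysics.KineticTheory.IsHardSphereEulerSolution σ T ρ u θ → ∀ Φ : (N : ℕ) → Literature.Analysis.FluidPDE.HardSphereFlow (Literature.Analysis.FluidPDE.Torus.geometry (Fin 3)) (Literature.MathematicalPhysics.KineticTheory.hsDiameter σ N) (N + 1), (∀ N, MeasureTheory.IsProbabilityMeasure (Literature.MathematicalPhysics.KineticTheory.localGibbsLaw σ a₀ u₀ θ₀ N (Φ N))) ∧ (Literature.MathematicalPhysics.KineticTheory.TendstoHydroFieldsAt (fun N => Literature.MathematicalPhysics.KineticTheory.localGibbsLaw σ a₀ u₀ θ₀ N (Φ N)) Φ ρ u θ 0 → ∀ t ∈ Set.Ico 0 T, ∃ a : Literature.MathematicalPhysics.KineticTheory.T3 → ℝ, (∀ N, MeasureTheory.IsProbabilityMeasure (Literature.MathematicalPhysics.KineticTheory.localGibbsLaw σ a (u t) (θ t) N (Φ N))) ∧ (∀ χ : Literature.MathematicalPhysics.KineticTheory.T3 → ℝ, Continuous χ → ∀ δ : ℝ, 0 < δ → ∃ C : ℝ, 0 < C ∧ ∀ N : ℕ, Literature.MathematicalPhysics.KineticTheory.localGibbsLaw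 σ a (u t) (θ t) N (Φ N) {z | δ < |Literature.MathematicalPhysics.KineticTheory.empiricalDensityField z χ - ∫ x, χ x * ρ t x|} ≤ ENNReal.ofReal (C * Real.exp (-(C⁻¹ * (N + 1)))) ∧ Literature.MathematicalPhysics.KineticTheory.localGibbsLaw σ a (u t) (θ t) N (Φ N) {z | δ < ‖Literature.MathematicalPhysics.KineticTheory.empiricalMomentumField z χ - ∫ x, (χ x * ρ t x) • u t x‖} ≤ ENNReal.ofReal (C * Real.exp (-(C⁻¹ * (N + 1)))) ∧ Literature.MathematicalPhysics.KineticTheory.localGibbsLaw σ a (u t) (θ t) N (Φ N) {z | δ < |Literature.MathematicalPhysics.KineticTheory.empiricalEnergyField z χ - ∫ x, χ x * Literature.MathematicalPhysics.KineticTheory.totalEnergyDensity (ρ t x) (u t x) (θ t x)|} ≤ ENNReal.ofReal (C * Real.exp (-(C⁻¹ * (N + 1))))) ∧ Filter.Tendsto (fun N : ℕ => InformationTheory.klDiv ((Φ N).lawAt (Literature.MathematicalPhysics.KineticTheory.localGibbsLaw σ a₀ u₀ θ₀ N (Φ N)) t) (Literature.MathematicalPhysics.KineticTheory.localGibbsLaw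 σ a (u t) (θ t) N (Φ N)) / ((N : ENNReal) + 1)) Filter.atTop (nhds 0))

/-- item stmt-AtomisticToContinuum-3654 · crux · rank 2 · closed · moot by None · by planner
why it might fail: a hidden slow one-body mode at fixed σ³ (none expected in the d=3 gas phase: kernel of the linearised hard-sphere operator = collision invariants), or ring/recollision correlations keeping scale-N exponential moments of window averages ≥ cβ² beyond Lanford's time — open even for global Gibbs data.
sources: OllaVaradhanYau1993, KipnisLandim1999, BGSSAnnals2023, BGSSCPAM2023, BodineauEtAl2024, LeBihan2022
[crux] FINITE-KINETIC-WINDOW LARGE DEVIATIONS OF FAST ONE-BODY FUNCTIONALS FROM LOCAL GIBBS DATA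
(card crux 1, kinetic part). For continuous profiles a, θ₀ > 0, u₀ there is σ₀ > 0 such that for 0 <
σ < σ₀, every family of hard-sphere flows Φ_N (N+1 spheres of diameter hsDiameter σ N on 𝕋³) and
every continuous F : 𝕋³ × ℝ³ → ℝ with |F(x,v)| ≤ C(1+|v|²) that is orthogonal, under the local
Maxwellian M_{1,u₀(x),θ₀(x)} at every x, to 1, v_j (j = 1,2,3) and |v|²: ∃ β₀ > 0 ∀ |β| ≤ β₀ ∀ ε > 0
∃ τ > 0 ∃ N₀ ∀ N ≥ N₀: ∫ exp(β Σ_i w_N⁻¹ ∫₀^{w_N} F(x_i(r), v_i(r)) dr) dλ^N ≤ exp(ε(N+1)), where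
w_N = τ(N+1)^{-1/3} (finitely many mean free times), (x_i(r), v_i(r)) = (Φ_N.flow r z)_i and λ^N =
localGibbsLaw σ a u₀ θ₀ N Φ_N. I.e. Λ_τ(β) := limsup_N (N+1)⁻¹ log E exp(β(N+1)Ȳ_τ) can be made ≤ ε
by ONE suitable window, at FIXED small β — exactly what the entropy Gronwall consumes; no rate, no
monotonicity in τ, no uniformity of mixing in N. Finite at each N for |β| ≤ β₀ (quadratic growth +
conservation of Σ|v_i|² + Gaussian data). Fails, correctly, for slow F (conserved densities: Λ_τ ≡
static value) and for the ideal gas (free flight: Λ_τ ≡ Λ at τ → 0⁺). [difficulty: open-problem] -/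
@[route_item "route-AtomisticToContinuum-KineticWindows"]
def KineticWindowLD : Prop :=
  ∀ (a θ₀ : Literature.MathematicalPhysics.KineticTheory.T3 → ℝ) (u₀ : Literature.MathematicalPhysics.KineticTheory.T3 → Literature.MathematicalPhysics.KineticTheory.V3), Continuous a → Continuous θ₀ → Continuous u₀ → (∀ x, 0 < a x) → (∀ x, 0 < θ₀ x) → ∃ σ₀ : ℝ, 0 < σ₀ ∧ ∀ σ : ℝ, 0 < σ → σ < σ₀ → ∀ Φ : (N : ℕ) → Literature.Analysis.FluidPDE.HardSphereFlow (Literature.Analysis.FluidPDE.Torus.geometry (Fin 3)) (Literature.MathematicalPhysics.KineticTheory.hsDiameter σ N) (N + 1), ∀ F : Literature.MathematicalPhysics.KineticTheory.T3 × Literature.MathematicalPhysics.KineticTheory.V3 → ℝ, Continuous F → (∃ C : ℝ, ∀ y, |F y| ≤ C * (1 + ‖y.2‖ ^ 2)) → (∀ x, ∫ v, F (x, v) * Literature.Analysis.FluidPDE.localMaxwellian 1 (θ₀ x) (u₀ x) v = 0) → (∀ x (j : Fin 3), ∫ v, F (x, v) * v j * Literature.Analysis.FluidPDE.localMaxwellian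 1 (θ₀ x) (u₀ x) v = 0) → (∀ x, ∫ v, F (x, v) * ‖v‖ ^ 2 * Literature.Analysis.FluidPDE.localMaxwellian 1 (θ₀ x) (u₀ x) v = 0) → ∃ β₀ : ℝ, 0 < β₀ ∧ ∀ β : ℝ, |β| ≤ β₀ → ∀ ε : ℝ, 0 < ε → ∃ τ : ℝ, 0 < τ ∧ ∃ N₀ : ℕ, ∀ N : ℕ, N₀ ≤ N → ∫⁻ z, ENNReal.ofReal (Real.exp (β * ∑ i : Fin (N + 1), (τ * ((N : ℝ) + 1) ^ (-(1 / 3 : ℝ)))⁻¹ * ∫ r in (0 : ℝ)..(τ * ((N : ℝ) + 1) ^ (-(1 / 3 : ℝ))), F (((Φ N).flow r z) i))) ∂(Literature.MathematicalPhysics.KineticTheory.localGibbsLaw σ a u₀ θ₀ N (Φ N)) ≤ ENNReal.ofReal (Real.exp (ε * ((N : ℝ) + 1)))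

-- item stmt-AtomisticToContinuum-3678 · crux · rank 3 · closed · moot by None · by planner — informal only, no Lean statement yet:
--   [crux] COLLISIONAL-TRANSFER WINDOW LD (card kinetic-windows-inside-yau crux 1, collisional part;
--   typable after the definition request `collisionSum`). Same frame as KineticWindowLD (continuous
--   profiles (a,u₀,θ₀) > 0; ∃ σ₀ ∀ σ ∈ (0,σ₀); ∀ flow families Φ_N; ∃ β₀ ∀ |β| ≤ β₀ ∀ ε > 0 ∃ τ > 0 ∃ N₀
--   ∀ N ≥ N₀; window w_N = τ(N+1)^{-1/3}; reference law λ^N = localGibbsLaw σ a u₀ θ₀ N Φ_N), with the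
--   one-body functional replaced by the FAST PART OF THE COLLISIONAL MOMENTUM/ENERGY TRANSFER over the
--   window: for smooth weights φ : 𝕋³ → (3×3 matrices), χ : 𝕋³ → ℝ³, let C_w(z) := w_N⁻¹ Σ over the
--   collisions (

/-- item stmt-AtomisticToContinuum-3655 · crux · rank 4 · closed · moot by None · by planner
why it might fail: the deterministic dynamics could focus energy ~N^{2/3} on O(1) particles with non-vanishing probability (f_s ≤ e^{κN}·Gibbs only excludes events of Gibbs-cost e^{-κ'N}, and cubic tails have sub-exponential LD cost); no maximum principle for hard-sphere energy cascades is known.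
sources: NachtergaeleYau2003, OllaVaradhanYau1993, Spohn1991
[crux] UNIFORM INTEGRABILITY OF THE ENERGY-CURRENT TAILS BEFORE THE FIRST SHOCK (card crux 3's
irreducible tail input; the consumable, corrected form of RelEntropyErgodic's LargeVelocityControl
0781, whose exponential-cubic-moment wording is false already at t = 0). For continuous profiles ∃
σ₀ ∀ σ ∈ (0,σ₀) ∀ classical hs-Euler solutions (ρ,u,θ) on [0,T) ∀ flow families Φ_N: if the local
Gibbs fields converge at t = 0 to (ρ,ρu,E)(0), then ∀ t < T ∀ ε > 0 ∃ M ∃ N₀ ∀ N ≥ N₀ ∀ s ∈ [0,t]: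
E_{λ^N}[(N+1)⁻¹ Σ_i |v_i(s)|³ 1{|v_i(s)| > M}] ≤ ε, v_i(s) the velocities of (Φ_N.flow s z). On
pre-shock horizons it follows from the catalogued open hypothesis
Literature.Barriers.AtomisticToContinuum.HighMomentumCutoff σ (Nachtergaele–Yau II.1 transcribed),
which is NOT assumed here (the item is weaker: cubic uniform integrability in mean, pre-shock only,
σ₀ profile-dependent). [difficulty: open-problem] -/
@[route_item "route-AtomisticToContinuum-KineticWindows"]
def EnergyCurrentTails : Prop :=
  ∀ (a₀ θ₀ : Literature.MathematicalPhysics.KineticTheory.T3 → ℝ) (u₀ : Literature.MathematicalPhysics.KineticTheory.T3 → Literature.MathematicalPhysics.KineticTheory.V3), Continuous a₀ → Continuous θ₀ → Continuous u₀ → (∀ x, 0 < a₀ x) → (∀ x, 0 < θ₀ x) → ∃ σ₀ : ℝ, 0 < σ₀ ∧ ∀ σ : ℝ, 0 < σ → σ < σ₀ → ∀ (T : ℝ) (ρ θ : ℝ → Literature.MathematicalPhysics.KineticTheory.T3 → ℝ) (u : ℝ → Literature.MathematicalPhysics.KineticTheory.T3 → Literature.MathematicalPhysics.KineticTheory.V3),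 Literature.MathematicalPhysics.KineticTheory.IsHardSphereEulerSolution σ T ρ u θ → ∀ Φ : (N : ℕ) → Literature.Analysis.FluidPDE.HardSphereFlow (Literature.Analysis.FluidPDE.Torus.geometry (Fin 3)) (Literature.MathematicalPhysics.KineticTheory.hsDiameter σ N) (N + 1), Literature.MathematicalPhysics.KineticTheory.TendstoHydroFieldsAt (fun N => Literature.MathematicalPhysics.KineticTheory.localGibbsLaw σ a₀ u₀ θ₀ N (Φ N)) Φ ρ u θ 0 → ∀ t ∈ Set.Ico 0 T, ∀ ε : ℝ, 0 < ε → ∃ M : ℝ, ∃ N₀ : ℕ, ∀ N : ℕ, N₀ ≤ N → ∀ s ∈ Set.Icc 0 t, ∫⁻ z, ENNReal.ofReal (((N : ℝ) + 1)⁻¹ * ∑ i : Fin (N + 1), Set.indicator {v : Literature.MathematicalPhysics.KineticTheory.V3 | M < ‖v‖} (fun v => ‖v‖ ^ 3) (((Φ N).flow s z i).2)) ∂(Literature.MathematicalPhysics.KineticTheory.localGibbsLaw σ a₀ u₀ θ₀ N (Φ N)) ≤ ENNReal.ofReal ε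

/-- item stmt-AtomisticToContinuum-3656 · support · rank 9 · closed · moot by None · by planner
sources: BGSSCPAM2023, BodineauEtAl2024, LeBihan2022, BodineauGallagherSaintRaymondInvent2016
[support] THE CHEAPEST TYPED SPECIAL CASE (card: "stake out first"): KineticWindowLD for GLOBAL
Gibbs data (constant activity a₀ > 0, u₀ = 0, constant temperature θ₀ > 0) and the kinetic SHEAR
stress F(x,v) = φ(x)·v¹v² (continuous φ; automatically orthogonal to 1, v, |v|² under the centred
Maxwellian). Here the reference law is flow-INVARIANT (canonical Gibbs), so Λ_{2τ} ≤ Λ_τ by Hölder,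
the long-finite-time equilibrium technology (BGSSCPAM2023, BodineauEtAl2024, LeBihan2022) applies
verbatim in time, and only the passage Boltzmann–Grad → fixed small σ³ over a FINITE window is new.
First theorem to aim at; its negation kills the whole line. [difficulty: open-problem] -/
@[route_item "route-AtomisticToContinuum-KineticWindows"]
def EquilibriumShearWindowLD : Prop :=
  ∀ (a₀ θ₀ : ℝ), 0 < a₀ → 0 < θ₀ → ∃ σ₀ : ℝ, 0 < σ₀ ∧ ∀ σ : ℝ, 0 < σ → σ < σ₀ → ∀ Φ : (N : ℕ) → Literature.Analysis.FluidPDE.HardSphereFlow (Literature.Analysis.FluidPDE.Torus.geometry (Fin 3)) (Literature.MathematicalPhysics.KineticTheory.hsDiameter σ N) (N + 1), ∀ φ : Literature.MathematicalPhysics.KineticTheory.T3 → ℝ, Continuous φ → ∃ β₀ : ℝ, 0 < β₀ ∧ ∀ β : ℝ, |β| ≤ β₀ → ∀ ε : ℝ, 0 < ε → ∃ τ : ℝ, 0 < τ ∧ ∃ N₀ : ℕ, ∀ N : ℕ, N₀ ≤ N → ∫⁻ z, ENNReal.ofReal (Real.exp (β * ∑ i : Fin (N + 1), (τ * ((N :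 ℝ) + 1) ^ (-(1 / 3 : ℝ)))⁻¹ * ∫ r in (0 : ℝ)..(τ * ((N : ℝ) + 1) ^ (-(1 / 3 : ℝ))), φ ((Φ N).flow r z i).1 * (((Φ N).flow r z i).2 0 * ((Φ N).flow r z i).2 1))) ∂(Literature.MathematicalPhysics.KineticTheory.localGibbsLaw σ (fun _ => a₀) (fun _ => 0) (fun _ => θ₀) N (Φ N)) ≤ ENNReal.ofReal (Real.exp (ε * ((N : ℝ) + 1)))

-- item stmt-AtomisticToContinuum-3681 · support · rank 9 · closed · moot by None · by planner — informal only, no Lean statement yet: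
--   [support] ENTROPY-CLOCK REDUCTION (glue; the "two clocks" interface): KineticWindowLD ∧
--   CollisionalWindowLD ∧ EnergyCurrentTails ∧ LocalGibbsConcentration (0767) ∧ VirialEosIdentification
--   (0782, incl. its linear-response/fluctuation–response form and canonical–grand-canonical equivalence
--   at packing < η₀) ∧ HsEosLowDensity (0768) ⟹ RelEntropyVanishing (0766). Proof shape: (i) exact
--   entropy-production identity for hard-sphere flows relative to the time-dependent local Gibbs law ψ_t
--   = localGibbsLaw σ a(ρ_t,σ) u_t θ_t: H(f_t|ψ_t) = H(f_0|ψ_t∘Φ_t) by Liouville invariance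
--   (HardSphereFlow.measurePres

/-- item stmt-AtomisticToContinuum-0769 · assembly · rank 1 · open · by planner
sources: Yau1991, OllaVaradhanYau1993, KipnisLandim1999
[assembly] X_RE → HydrodynamicLimit: entropy inequality μ(A) ≤ (log 2 + H(μ|λ))/log(1 + 1/λ(A))
(from Donsker–Varadhan / Mathlib klDiv API) with λ(A) ≤ C e^{-(N+1)/C} and H = o(N) gives μ(A) → 0;
μ = lawAt (Φ N) P t = P.map (flow t) turns μ{z | δ < |field z − ·|} into P{z | δ < |field (flow t z)
− ·|} (measurable_flow); the reference concentration is stated for z itself and TendstoHydroFieldsAt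
at time 0 of the reference law is not needed. Zero-mass case impossible by the IsProbabilityMeasure
clauses; take σ₀ from X_RE. -/
@[route_item "route-AtomisticToContinuum-KineticWindows"]
def Assembly : Prop :=
  RelEntropyVanishing → Literature.MathematicalPhysics.KineticTheory.HydrodynamicLimit

end Summit.AtomisticToContinuum.HydrodynamicLimit.Theses.KineticWindows
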